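import Literature.MathematicalPhysics.QuantumFieldTheory.Balaban1983to89.Node00.HistoryTermDatum214WindowDilated
import Literature.MathematicalPhysics.QuantumFieldTheory.Balaban1983to89.Node00.HistoryAdmissibleClass
import Literature.Analysis.Complex.HolomorphicParametricIntegral

/-!
# NODE 00 (YM-PLAN Track A) — W1 = [II] §2 (2.13)–(2.14), STOREY 17: THE (1.33)∕(1.41) READING OF THE HISTORY BY THE OLDER-TERMS
# POTENTIAL, AS AN OBJECT (`W1.TermDatum214.ReadingAtoms`, `ReadingAtoms.potential`, `W1.TermDatum214.readOlder`, the laws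
# `MapsToTables ∕ CfgHoloOn ∕ CfgContinuous ∕ CfgJointContinuous ∕ KernelBounded ∕ FiniteMass ∕ LocalIn`, the schema `ReadsBy ∕ ReadsOnBy`)

NODE 00 DEFINER MODULE (seat `pub-ymgap-node00-def-W1`, generation 22, 2026-08-27).  APPEND-ONLY: a NEW importing module; g13's
`Node00/HistoryTermDatum214WindowDilated` (`TermDatum214.UnscaledOlder`, `UnscaledFieldLawOn`), g17's `Node00/HistoryAdmissibleClass`
(`W1.SizeAdm`, `W1.FieldAdm`, `W1.AdmHist`) and `Literature.Analysis.Complex.HolomorphicParametricIntegral`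
(`differentiableOn_integral_of_dominated`) untouched and CONSUMED BY NAME.  Typed on the pub-ymgap bus for the consumer-named thread of seat
`pub-ymgap-dag-n22-c` g9 (record `SliceInputsLGU`, located inputs `h𝒪m ∕ h𝒪d ∕ hloc𝒪 ∕ hOhol` on the OPAQUE older-terms potential
`𝒪 : 𝔇.UnscaledOlder`; NOTES «further storey candidates: hOhol from 𝒪's (1.41) law once def-W1 types it»).

## What this storey types, and why

W1-11 (`HistoryTermDatum214WindowDilated`) reads the last-line potential of a (2.14) term datum in the UNSCALED field as
`𝐕_k(Y; s, old, φ; B) = s⁻²·𝒲(φ; Y, sB) + 𝒪(old, φ; Y, sB)` with an OPAQUE older-terms part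
`𝒪 : (Z t) → OlderTerms → CPair → TDom → (Λ → ℝ) → ℂ` — an ARBITRARY functional of the history `old = (E^{(j)}(X; ·))_{j ≤ k}`.  In print it is
not arbitrary.  [I] §3 writes the history's contribution to the fluctuation-field action as the difference (3.3)
`E^{(j)}(U_j(U′_k(exp iB′ V′_k))) − E^{(j)}(U_j(U′_k(V′_k)))`, interpolates it — (3.4): `= Σ_□ ∫₀¹ dt (∂∕∂t_□) E^{(j)}(U_j(exp i Q_j(Σ_□′ t H_k B′ …) U_{k+1}), …)`
— substitutes the configuration family (3.10) `U′ = exp(iξA) U_{k+1}, J′ = …` («It is obtained from the analytic function E^{(j)}(X, U′, J′) by the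
substitution (3.10)», p. 272), and represents the `t_□`-derivative «as the Cauchy integral» (3.15) `(2πi)⁻¹ ∮_{|t_□| = r} dt_□ t_□⁻² E^{(j)}(X, …)`
(p. 273), the moved configurations staying in the analyticity space `U^c_j(X, …)` of the older term ((3.17)–(3.18) p. 273; [I] §1 p. 263:
«E^{(j)}(X, g_{j−1}, U, J) is defined and analytic on the space U^c_j(X, α₀, α₁)»).  [II] §1 does the same with the decoupling parameters —
(1.10) p. 4: `Σ_{Y₀} ∫ ds(Y₀) ∂^{s(Y₀)} (…)`, (1.23) p. 7: «we represent all derivatives by the Cauchy formula … the t_□-integration is over the circle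
(1.22), and the σ(Δ)-integrations are over the circles |σ(Δ)| = e^{κ₁}» — and sums the localized pieces: Lemma 1 (1.33) p. 9
`E_k(U_k(exp iB′ V′^{(k)})) − E_k(U_k(V′^{(k)})) = Σ_{Y ∈ 𝐃_k} 𝐕′_k(Y, U_{k+1}, B)`, each term «defined and analytic on the space (1.34)» with (1.35);
Lemma 2 (1.41)–(1.42) p. 11: `𝐕_k(Y, U, J, B) = ⟨B, Δ_k(Y; U, J) B⟩ + 𝐕″_k(Y, U, J, B)`; [II] p. 15 ll. 19–20: (2.14) «as an analytic function of (U, J)».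

So the older-terms potential is, slice by slice, a SUM OVER LEVELS `j ≤ k` AND DOMAINS `X ∈ 𝐃_j` OF INTEGRALS, against interpolation ∕ decoupling
∕ contour measures, OF A KERNEL TIMES THE OLDER TERM `E^{(j)}(X; ·)` EVALUATED AT A CONFIGURATION FAMILY that moves ANALYTICALLY with the
reference configuration `ξ` and CONTINUOUSLY with the parameters, and stays in the table of `E^{(j)}(X; ·)`.  This storey types exactly that
OBJECT — `ReadingAtoms` = (measures `μ`, kernels `K`, configuration families `cfg`) per `(Y, j, X)`, `ReadingAtoms.potential` = the sum of
integrals, `readOlder R : 𝔇.UnscaledOlder` = the datum-level reading (n22-c's `𝒪` signature on the nose) — its LAWS as displayed `Prop`s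
(`MapsToTables`: the moved configurations lie in the tables, (3.17)–(3.18) ∕ (1.34)–(1.35); `CfgHoloOn`: analytic in `ξ`; `CfgContinuous` ∕
`CfgJointContinuous`: continuous in the parameters (and the field); `KernelBounded`, `FiniteMass`: bounded measurable kernels, finite measures;
`LocalIn S₀`: the configuration family reads the field only in `S₀`, [II] (2.2)–(2.3)), the hypothesis SCHEMA on an opaque `𝒪` (`ReadsBy` global,
`ReadsOnBy` located on admissible histories × a configuration window × a field set), two HONESTY instances (`ReadingAtoms.zero`,
`ReadingAtoms.eval`), print's located field set `FieldBox S₀ ρ`, and the FACES a consumer needs: the reading sees the history ONLY ON THE TABLES (`potential_congr_of_eqOn_tables`), is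
`ℂ`-homogeneous in it, is `Y`-local in the field when the configuration family is (`potential_local_of_localIn` = the record's `hloc𝒪` shape),
carries the crude (1.18)-size of an admissible history (`norm_potential_le_of_sizeAdm`; NOT print's (1.36) — no decay in `d_k(Y)` is claimed), and —
the point of the storey — is HOLOMORPHIC IN THE CONFIGURATION for every admissible history (`differentiableOn_potential_config_of_admHist` = the
record's `h𝒪d`), HOLOMORPHIC ALONG EVERY ADMISSIBLE HOLOMORPHIC HISTORY CURVE (`differentiableOn_potential_history_of_curve` = the record's `hOhol`,
binder for binder) and CONTINUOUS IN THE FIELD ON THE FIELD SET (`continuousOn_potential_field_of_admHist`), hence, for the clamped reading, CONTINUOUS and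
MEASURABLE IN THE FIELD (`continuous_potential_field_of_admHist`, `measurable_potential_field_of_admHist` = the record's `h𝒪m`), each by ONE application of the dominated holomorphic ∕ continuous parametric-integral lemma to a bounded kernel times an
analytic-on-the-table function of a configuration moving inside the table.

The field set `𝔅 : Set (Λ → ℝ)` of the laws: print's reading is located on the ε₁-box `{A | ∀ b ∈ S₀, |A b| ≤ ρ}` ((1.34): `|B| < ε₁g_k⁻¹ on Y`);
a producer who clamps the configuration family outside the box (where the small-field characteristic function vanishes, [I] (2.9)) may take
`𝔅 = univ`, which is the shape the N22 s1 record quantifies (`∀ A`).  Both are instances of the same displayed laws.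

HONEST LIMITS.  Hypothesis-schema style: an OBJECT and its laws, NOTHING asserted of print's data; the PRODUCER (NODE A at the record) still owes
a reading `R` WITH the laws at the datum of record — N22 is NOT discharged here; no estimate of print ((1.33)'s (1.36), (1.42)–(1.43), [I] (3.9),
(3.14)) is claimed or re-proved; the quadratic-form part `⟨B, Δ_k(Y) B⟩` of (1.42) is the Wilson side (`𝒲`), not read here.

## CITATION HEADER (D-0065)
- [II] = T. Bałaban, Renormalization group approach to lattice gauge field theories. II. Cluster expansions, Comm. Math. Phys. 116 (1988) 1–22
  [Balaban1988RG2Cluster]: (1.10) p. 4 with p. 5 ll. 4–6 «To estimate a term in the sum (1.10) we use the Cauchy formula, hence we have to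
  investigate analyticity properties of the functions E(·) with respect to the variables s(Y₀)»; (1.23) p. 7 ll. 14–19; Lemma 1 (1.33)–(1.36)
  p. 9 ll. 28–38; Lemma 2 (1.41)–(1.43) p. 11 ll. 14–26; (2.14) p. 15 with ll. 19–20.
- [I] = T. Bałaban, Renormalization group approach to lattice gauge field theories. I, Comm. Math. Phys. 109 (1987) 249–301 [Balaban1987RG1]:
  §1 p. 263 (analyticity of `E^{(j)}` on `U^c_j`, (1.18)); (3.2)–(3.4) p. 270; (3.10)–(3.13) p. 272; (3.15)–(3.18) p. 273.
- Pages were read from the materialised texts `paper:balaban1988-cmp116-rg-ii-cluster` pp. 4–11, 15 and `paper:balaban1987-cmp109-rg-i-small-field`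
  pp. 263, 270–273 (journal pagination).

Typer lint: no `instance`, no `notation`, no attribute removal, no `sorry`; one file for one source section (the reading behind (1.33)∕(1.41)).
-/

open scoped BigOperators

noncomputable section

namespace Literature.MathematicalPhysics.QuantumFieldTheory.Balaban1983to89.Node00

open Metric Set Filter
open _root_.MeasureTheory
open Literature.MathematicalPhysics.QuantumFieldTheory.Balaban1983to89
open TreeLengthTorus Sect2

namespace W1

namespace TermDatum214

variable {c : B13.Consts} {P : Params} {𝔸 : Type*} {M k L : ℕ} [NeZero L] (𝔇 : TermDatum214 c P 𝔸 M k L)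

/-! ## §1  The atoms of a reading of the older terms at one term slice, and the read potential -/

/-- **THE ATOMS OF A READING OF THE OLDER TERMS AT THE TERM SLICE `(Z, t)`** over a parameter space `S` (the interpolation times `t ∈ [0,1]` of
[I] (3.4), the decoupling parameters `s(Y₀)` of [II] (1.10), the contour variables `t_□`, `σ(Δ)` of [I] (3.15) ∕ [II] (1.23), or any product of
these): per localization domain `Y` of the new step, level `j ≤ k` and domain `X ∈ 𝐃_j` of the older term — a MEASURE `μ Y j X` on `S`
(Lebesgue ∕ arc-length ∕ their products, or zero when `E^{(j)}(X; ·)` does not contribute to `Y`), a KERNEL `K Y j X : S → ℂ` (the Cauchy kernels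
`(2πi)⁻¹ t_□⁻²`, signs, combinatorial weights) and a CONFIGURATION FAMILY `cfg Y j X : ξ ↦ A ↦ s ↦` the configuration at which `E^{(j)}(X; ·)` is
evaluated ([I] (3.10) `U′ = exp(iξA)U_{k+1}`, (3.18)).  Pure data; the laws are the displayed `Prop`s of §2.
[cite: Balaban1987RG1, (3.3)-(3.4) p.270, (3.10) p.272 and (3.15)-(3.18) p.273; Balaban1988RG2Cluster, (1.10) p.4, (1.23) p.7, Lemma 1 (1.33)-(1.35) p.9 and Lemma 2 (1.41)-(1.42) p.11] -/
structure ReadingAtoms (Z : (domSys P M (k + 1)).Dom) (t : TermLabel P M k L) (S : Type*) [MeasurableSpace S] where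
  /-- the integration measure of the atom `(Y, j, X)` -/
  μ : TDom P.d (L * domCount P M (k + 1)) → (j : Fin (k + 1)) → (domSys P M j).Dom → Measure S
  /-- the kernel of the atom `(Y, j, X)` -/
  K : TDom P.d (L * domCount P M (k + 1)) → (j : Fin (k + 1)) → (domSys P M j).Dom → S → ℂ
  /-- the configuration family of the atom `(Y, j, X)`: reference configuration `ξ`, unscaled row-bond field `A`, parameter `s` ↦ the moved
  configuration -/
  cfg : TDom P.d (L * domCount P M (k + 1)) → (j : Fin (k + 1)) → (domSys P M j).Dom → CPair P 𝔸 → ((𝔇.𝒦 Z t).Λ → ℝ) → S → CPair P 𝔸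

namespace ReadingAtoms

variable {𝔇}
variable {Z : (domSys P M (k + 1)).Dom} {t : TermLabel P M k L} {S : Type*} [MeasurableSpace S] (R : 𝔇.ReadingAtoms Z t S)

/-- **THE READ OLDER-TERMS POTENTIAL `𝒪_R(old, ξ; Y, A)`** of the reading `R`: the sum over levels `j ≤ k` and domains `X ∈ 𝐃_j` of the integrals
`∫ K_{Y,j,X}(s) · E^{(j)}(X; cfg_{Y,j,X}(ξ, A, s)) dμ_{Y,j,X}(s)` — the shape of every term of (3.4) after (3.10) and (3.15), summed as in (1.33) ∕
(1.41).  (Bochner integral; junk `0` on a non-integrable atom — the laws of §2 make every atom of an admissible history integrable.)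
[cite: Balaban1987RG1, (3.4) p.270, (3.10) p.272 and (3.15) p.273; Balaban1988RG2Cluster, Lemma 1 (1.33) p.9 and Lemma 2 (1.41) p.11] -/
def potential (old : OlderTerms P 𝔸 M k) (ξ : CPair P 𝔸) (Y : TDom P.d (L * domCount P M (k + 1))) (A : (𝔇.𝒦 Z t).Λ → ℝ) : ℂ :=
  ∑ j : Fin (k + 1), ∑ X : (domSys P M j).Dom, ∫ s, R.K Y j X s * old j X (R.cfg Y j X ξ A s) ∂(R.μ Y j X)

/-- The read potential unfolded (`rfl`). [cite: Balaban1988RG2Cluster, Lemma 1 (1.33) p.9 (bookkeeping)] -/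
theorem potential_eq (old : OlderTerms P 𝔸 M k) (ξ : CPair P 𝔸) (Y : TDom P.d (L * domCount P M (k + 1))) (A : (𝔇.𝒦 Z t).Λ → ℝ) :
    R.potential old ξ Y A = ∑ j : Fin (k + 1), ∑ X : (domSys P M j).Dom, ∫ s, R.K Y j X s * old j X (R.cfg Y j X ξ A s) ∂(R.μ Y j X) :=
  rfl

/-! ## §2  The laws of a reading (displayed `Prop`s, nothing asserted) -/

/-- **LAW: the moved configurations stay in the tables.**  For reference configurations `ξ` in the window `W` and fields `A` in the field set `𝔅`,
every configuration `cfg_{Y,j,X}(ξ, A, s)` lies in the table `sp j X` on which `E^{(j)}(X; ·)` is bounded and analytic ([I] (3.17)–(3.18) p. 273: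
the configurations of (3.4) lie in `U^c_j(X, …)`; [II] (1.34)–(1.35) p. 9).
[cite: Balaban1987RG1, (3.17)-(3.18) p.273 and §1 p.263; Balaban1988RG2Cluster, (1.34)-(1.35) p.9] -/
def MapsToTables (sp : (j : ℕ) → (domSys P M j).Dom → Set (CPair P 𝔸)) (W : Set (CPair P 𝔸)) (𝔅 : Set ((𝔇.𝒦 Z t).Λ → ℝ)) : Prop :=
  ∀ (Y : TDom P.d (L * domCount P M (k + 1))) (j : Fin (k + 1)) (X : (domSys P M j).Dom), ∀ ξ ∈ W, ∀ A ∈ 𝔅, ∀ s : S,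
    R.cfg Y j X ξ A s ∈ sp j X

/-- **PRINT'S LOCATED FIELD SET: the ε₁-box on the coordinates `S₀`** — `{A | |A(b)| ≤ ρ for b ∈ S₀}` ([II] (1.34) p. 9: `|B| < ε₁g_k⁻¹ on Y`,
i.e. `|A| ≤ ε₁` in the unscaled field; the box-support coordinates `S₀` of (2.2)–(2.3); the consequent of W1-12's box-support law `hbox`).  The
field set `𝔅` of the laws is meant to be this box (print's located reading) or `univ` (a reading clamped outside the box).
[cite: Balaban1988RG2Cluster, (1.34) p.9 and (2.2)-(2.3) p.12; Balaban1987RG1, (2.9) p.266] -/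
def FieldBox (S₀ : Set (𝔇.𝒦 Z t).Λ) (ρ : ℝ) : Set ((𝔇.𝒦 Z t).Λ → ℝ) :=
  {A | ∀ b ∈ S₀, |A b| ≤ ρ}

/-- Face: membership in the field box, displayed (`Iff.rfl`). [cite: Balaban1988RG2Cluster, (1.34) p.9 (bookkeeping)] -/
theorem mem_fieldBox_iff {S₀ : Set (𝔇.𝒦 Z t).Λ} {ρ : ℝ} {A : (𝔇.𝒦 Z t).Λ → ℝ} :
    A ∈ FieldBox (𝔇 := 𝔇) (Z := Z) (t := t) S₀ ρ ↔ ∀ b ∈ S₀, |A b| ≤ ρ :=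
  Iff.rfl

/-- **LAW: the configuration families move analytically with the reference configuration** on the window `W`, for fields in `𝔅` ([I] p. 272
ll. 8–10: `E^{(j)}(X, exp(iξA)U_{k+1})` «is obtained from the analytic function E^{(j)}(X, U′, J′) by the substitution (3.10)»; [II] p. 15 ll. 19–20).
[cite: Balaban1987RG1, (3.10) p.272; Balaban1988RG2Cluster, (2.14) p.15] -/
def CfgHoloOn [NormedRing 𝔸] [NormedAlgebra ℂ 𝔸] (W : Set (CPair P 𝔸)) (𝔅 : Set ((𝔇.𝒦 Z t).Λ → ℝ)) : Prop :=
  ∀ (Y : TDom P.d (L * domCount P M (k + 1))) (j : Fin (k + 1)) (X : (domSys P M j).Dom), ∀ A ∈ 𝔅, ∀ s : S,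
    DifferentiableOn ℂ (fun ξ : CPair P 𝔸 => R.cfg Y j X ξ A s) W

/-- **LAW: the configuration families depend continuously on the parameters** (the interpolation ∕ contour variables of (3.4), (3.15), (1.10),
(1.23) enter through exponentials of bounded operators). [cite: Balaban1987RG1, (3.4) p.270 and (3.15) p.273; Balaban1988RG2Cluster, (1.23) p.7] -/
def CfgContinuous [TopologicalSpace S] [TopologicalSpace 𝔸] : Prop :=
  ∀ (Y : TDom P.d (L * domCount P M (k + 1))) (j : Fin (k + 1)) (X : (domSys P M j).Dom) (ξ : CPair P 𝔸) (A : (𝔇.𝒦 Z t).Λ → ℝ),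
    Continuous fun s : S => R.cfg Y j X ξ A s

/-- **LAW: the configuration families depend continuously on the field and the parameters jointly** (the field enters through `exp(iξA)`,
[I] (3.10)); implies `CfgContinuous` (`CfgJointContinuous.cfgContinuous`). [cite: Balaban1987RG1, (3.10) p.272] -/
def CfgJointContinuous [TopologicalSpace S] [TopologicalSpace 𝔸] : Prop :=
  ∀ (Y : TDom P.d (L * domCount P M (k + 1))) (j : Fin (k + 1)) (X : (domSys P M j).Dom) (ξ : CPair P 𝔸),
    Continuous fun p : ((𝔇.𝒦 Z t).Λ → ℝ) × S => R.cfg Y j X ξ p.1 p.2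

/-- **LAW: the kernels are measurable and bounded by `C`** (Cauchy kernels on circles of fixed radii, (3.15) ∕ (1.22)–(1.23)).
[cite: Balaban1987RG1, (3.15) p.273; Balaban1988RG2Cluster, (1.22)-(1.23) p.7] -/
def KernelBounded (C : ℝ) : Prop :=
  ∀ (Y : TDom P.d (L * domCount P M (k + 1))) (j : Fin (k + 1)) (X : (domSys P M j).Dom), Measurable (R.K Y j X) ∧ ∀ s : S, ‖R.K Y j X s‖ ≤ C

/-- **LAW: the measures are finite with total mass at most `m`** (unit intervals, cubes `[0,1]^{Y₀}`, circles).
[cite: Balaban1987RG1, (3.4) p.270 and (3.15) p.273; Balaban1988RG2Cluster, (1.10) p.4 and (1.23) p.7] -/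
def FiniteMass (m : ℝ) : Prop :=
  ∀ (Y : TDom P.d (L * domCount P M (k + 1))) (j : Fin (k + 1)) (X : (domSys P M j).Dom), IsFiniteMeasure (R.μ Y j X) ∧ (R.μ Y j X).real univ ≤ m

/-- **LAW: the configuration families of the domains `Y ∈ 𝐃 = t.1` read the field only in the coordinate set `S₀`** (the box-support coordinates
of [II] (2.2)–(2.3); the record's `hloc𝒪` then follows: `potential_local_of_localIn`). [cite: Balaban1988RG2Cluster, (2.2)-(2.3) p.12 and (1.34) p.9] -/
def LocalIn (S₀ : Set (𝔇.𝒦 Z t).Λ) : Prop :=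
  ∀ Y ∈ t.1, ∀ (j : Fin (k + 1)) (X : (domSys P M j).Dom) (ξ : CPair P 𝔸) (A A' : (𝔇.𝒦 Z t).Λ → ℝ), (∀ b ∈ S₀, A b = A' b) →
    ∀ s : S, R.cfg Y j X ξ A s = R.cfg Y j X ξ A' s

/-- Face: joint continuity in (field, parameter) gives continuity in the parameter. [cite: Balaban1987RG1, (3.10) p.272 (bookkeeping)] -/
theorem CfgJointContinuous.cfgContinuous [TopologicalSpace S] [TopologicalSpace 𝔸] {R : 𝔇.ReadingAtoms Z t S} (h : R.CfgJointContinuous) :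
    R.CfgContinuous :=
  fun Y j X ξ A => (h Y j X ξ).comp (Continuous.prodMk_right A)

/-- Face: a law on a larger field set restricts to a smaller one (`MapsToTables`). [cite: Balaban1988RG2Cluster, (1.34) p.9 (bookkeeping)] -/
theorem MapsToTables.mono {sp : (j : ℕ) → (domSys P M j).Dom → Set (CPair P 𝔸)} {W W' : Set (CPair P 𝔸)} {𝔅 𝔅' : Set ((𝔇.𝒦 Z t).Λ → ℝ)}
    (h : R.MapsToTables sp W 𝔅) (hW : W' ⊆ W) (h𝔅 : 𝔅' ⊆ 𝔅) : R.MapsToTables sp W' 𝔅' :=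
  fun Y j X ξ hξ A hA s => h Y j X ξ (hW hξ) A (h𝔅 hA) s

/-! ## §3  Honesty instances: the zero reading and the evaluation reading -/

/-- **The zero reading**: all measures zero (kernels zero, configurations unmoved) — the reading of a slice to which no older term contributes.
[cite: Balaban1988RG2Cluster, Lemma 1 (1.33) p.9 (degenerate instance)] -/
protected def zero : 𝔇.ReadingAtoms Z t S :=
  ⟨fun _ _ _ => 0, fun _ _ _ _ => 0, fun _ _ _ ξ _ _ => ξ⟩

/-- Face: the zero reading reads every history as `0`. [cite: Balaban1988RG2Cluster, Lemma 1 (1.33) p.9 (degenerate instance)] -/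
@[simp] theorem zero_potential (old : OlderTerms P 𝔸 M k) (ξ : CPair P 𝔸) (Y : TDom P.d (L * domCount P M (k + 1))) (A : (𝔇.𝒦 Z t).Λ → ℝ) :
    (ReadingAtoms.zero : 𝔇.ReadingAtoms Z t S).potential old ξ Y A = 0 := by
  simp [potential, ReadingAtoms.zero]

/-- **The evaluation reading** (parameter space `Unit`, Dirac measures): weights `w Y j X` and ONE moved configuration `cf Y j X ξ A` per atom —
the finite linear reading `Σ_j Σ_X w·E^{(j)}(X; cf(ξ, A))` (e.g. the two endpoint evaluations of (3.3) before interpolation).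
[cite: Balaban1987RG1, (3.3) p.270; Balaban1988RG2Cluster, Lemma 1 (1.33) p.9 (finite instance)] -/
protected def eval (w : TDom P.d (L * domCount P M (k + 1)) → (j : Fin (k + 1)) → (domSys P M j).Dom → ℂ)
    (cf : TDom P.d (L * domCount P M (k + 1)) → (j : Fin (k + 1)) → (domSys P M j).Dom → CPair P 𝔸 → ((𝔇.𝒦 Z t).Λ → ℝ) → CPair P 𝔸) :
    𝔇.ReadingAtoms Z t Unit :=
  ⟨fun _ _ _ => Measure.dirac (), fun Y j X _ => w Y j X, fun Y j X ξ A _ => cf Y j X ξ A⟩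

/-- Face: the evaluation reading's potential is the finite sum `Σ_j Σ_X w Y j X · E^{(j)}(X; cf Y j X ξ A)`.
[cite: Balaban1987RG1, (3.3) p.270; Balaban1988RG2Cluster, Lemma 1 (1.33) p.9 (finite instance)] -/
@[simp] theorem eval_potential (w : TDom P.d (L * domCount P M (k + 1)) → (j : Fin (k + 1)) → (domSys P M j).Dom → ℂ)
    (cf : TDom P.d (L * domCount P M (k + 1)) → (j : Fin (k + 1)) → (domSys P M j).Dom → CPair P 𝔸 → ((𝔇.𝒦 Z t).Λ → ℝ) → CPair P 𝔸)
    (old : OlderTerms P 𝔸 M k) (ξ : CPair P 𝔸) (Y : TDom P.d (L * domCount P M (k + 1))) (A : (𝔇.𝒦 Z t).Λ → ℝ) :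
    (ReadingAtoms.eval (𝔇 := 𝔇) (Z := Z) (t := t) w cf).potential old ξ Y A =
      ∑ j : Fin (k + 1), ∑ X : (domSys P M j).Dom, w Y j X * old j X (cf Y j X ξ A) := by
  simp [potential, ReadingAtoms.eval]

/-! ## §4  Algebraic faces: linearity in the history, history seen only on the tables, field locality, crude size -/

/-- Face: the zero history is read as `0`. [cite: Balaban1988RG2Cluster, Lemma 1 (1.33) p.9 (bookkeeping)] -/
@[simp] theorem potential_zero_old (ξ : CPair P 𝔸) (Y : TDom P.d (L * domCount P M (k + 1))) (A : (𝔇.𝒦 Z t).Λ → ℝ) :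
    R.potential 0 ξ Y A = 0 := by
  simp [potential]

/-- Face: the reading is `ℂ`-homogeneous in the history (a linear reading). [cite: Balaban1988RG2Cluster, Lemma 1 (1.33) p.9 (bookkeeping)] -/
theorem potential_smul_old (a : ℂ) (old : OlderTerms P 𝔸 M k) (ξ : CPair P 𝔸) (Y : TDom P.d (L * domCount P M (k + 1)))
    (A : (𝔇.𝒦 Z t).Λ → ℝ) : R.potential (a • old) ξ Y A = a * R.potential old ξ Y A := by
  simp only [potential, Pi.smul_apply, smul_eq_mul, Finset.mul_sum]
  refine Finset.sum_congr rfl fun j _ => Finset.sum_congr rfl fun X _ => ?_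
  rw [← integral_const_mul]
  exact integral_congr_ae (Eventually.of_forall fun s => by ring)

/-- Face: the reading is additive in the history on integrable atoms. [cite: Balaban1988RG2Cluster, Lemma 1 (1.33) p.9 (bookkeeping)] -/
theorem potential_add_old (old old' : OlderTerms P 𝔸 M k) (ξ : CPair P 𝔸) (Y : TDom P.d (L * domCount P M (k + 1))) (A : (𝔇.𝒦 Z t).Λ → ℝ)
    (h : ∀ (j : Fin (k + 1)) (X : (domSys P M j).Dom), Integrable (fun s => R.K Y j X s * old j X (R.cfg Y j X ξ A s)) (R.μ Y j X))
    (h' : ∀ (j : Fin (k + 1)) (X : (domSys P M j).Dom), Integrable (fun s => R.K Y j X s * old' j X (R.cfg Y j X ξ A s)) (R.μ Y j X)) :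
    R.potential (old + old') ξ Y A = R.potential old ξ Y A + R.potential old' ξ Y A := by
  simp only [potential, Pi.add_apply, mul_add, ← Finset.sum_add_distrib]
  refine Finset.sum_congr rfl fun j _ => Finset.sum_congr rfl fun X _ => ?_
  exact integral_add (h j X) (h' j X)

/-- **Face: the reading sees the history ONLY ON THE TABLES** — two histories agreeing on every table `sp j X` are read alike at every `ξ ∈ W`,
`A ∈ 𝔅` ([I] §1 p. 263: the older terms are functions on `U^c_j(X, α₀, α₁)`; (3.17)–(3.18): the moved configurations lie there).
[cite: Balaban1987RG1, §1 p.263 and (3.17)-(3.18) p.273] -/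
theorem potential_congr_of_eqOn_tables {sp : (j : ℕ) → (domSys P M j).Dom → Set (CPair P 𝔸)} {W : Set (CPair P 𝔸)}
    {𝔅 : Set ((𝔇.𝒦 Z t).Λ → ℝ)} (hmaps : R.MapsToTables sp W 𝔅) {old old' : OlderTerms P 𝔸 M k}
    (h : ∀ (j : Fin (k + 1)) (X : (domSys P M j).Dom), EqOn (old j X) (old' j X) (sp j X)) {ξ : CPair P 𝔸} (hξ : ξ ∈ W)
    (Y : TDom P.d (L * domCount P M (k + 1))) {A : (𝔇.𝒦 Z t).Λ → ℝ} (hA : A ∈ 𝔅) :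
    R.potential old ξ Y A = R.potential old' ξ Y A := by
  refine Finset.sum_congr rfl fun j _ => Finset.sum_congr rfl fun X _ => integral_congr_ae (Eventually.of_forall fun s => ?_)
  simp only [h j X (hmaps Y j X ξ hξ A hA s)]

/-- **Face: field locality of the read potential** (the record's `hloc𝒪` shape): if the configuration families of the domains `Y ∈ 𝐃` read
the field only in `S₀`, so does the read potential. [cite: Balaban1988RG2Cluster, (2.2)-(2.3) p.12 and (1.34) p.9] -/
theorem potential_local_of_localIn {S₀ : Set (𝔇.𝒦 Z t).Λ} (hloc : R.LocalIn S₀) (old : OlderTerms P 𝔸 M k) (ξ : CPair P 𝔸)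
    {Y : TDom P.d (L * domCount P M (k + 1))} (hY : Y ∈ t.1) {A A' : (𝔇.𝒦 Z t).Λ → ℝ} (hAA' : ∀ b ∈ S₀, A b = A' b) :
    R.potential old ξ Y A = R.potential old ξ Y A' := by
  refine Finset.sum_congr rfl fun j _ => Finset.sum_congr rfl fun X _ => integral_congr_ae (Eventually.of_forall fun s => ?_)
  simp only [hloc Y hY j X ξ A A' hAA' s]

/-- **Face: the crude (1.18)-size of the reading of a size-admissible history** (unlocalized: the (1.18) bound of each older term on its table,
times the kernel bound and the mass, summed over the atoms — NOT print's (1.36), which carries the decay in `d_k(Y)`).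
[cite: Balaban1987RG1, (1.18) p.263; Balaban1988RG2Cluster, (1.36) p.9 (the crude form only)] -/
theorem norm_potential_le_of_sizeAdm {sp : (j : ℕ) → (domSys P M j).Dom → Set (CPair P 𝔸)} {W : Set (CPair P 𝔸)}
    {𝔅 : Set ((𝔇.𝒦 Z t).Λ → ℝ)} {C m E₀ r₁ : ℝ} (hC : 0 ≤ C) (hE₀ : 0 ≤ E₀) (hmaps : R.MapsToTables sp W 𝔅) (hK : R.KernelBounded C)
    (hμ : R.FiniteMass m) {old : OlderTerms P 𝔸 M k} (hold : old ∈ SizeAdm sp E₀ r₁ k) {ξ : CPair P 𝔸} (hξ : ξ ∈ W)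
    (Y : TDom P.d (L * domCount P M (k + 1))) {A : (𝔇.𝒦 Z t).Λ → ℝ} (hA : A ∈ 𝔅) :
    ‖R.potential old ξ Y A‖ ≤ ∑ j : Fin (k + 1), ∑ X : (domSys P M j).Dom, C * (E₀ * Real.exp (-(r₁ * (domSys P M j).dj X))) * m := by
  refine (norm_sum_le _ _).trans (Finset.sum_le_sum fun j _ => (norm_sum_le _ _).trans (Finset.sum_le_sum fun X _ => ?_))
  obtain ⟨-, hKb⟩ := hK Y j X
  obtain ⟨hfin, hmass⟩ := hμ Y j X
  haveI := hfin
  have hc : 0 ≤ C * (E₀ * Real.exp (-(r₁ * (domSys P M j).dj X))) := mul_nonneg hC (mul_nonneg hE₀ (Real.exp_pos _).le)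
  have hpt : ∀ s, ‖R.K Y j X s * old j X (R.cfg Y j X ξ A s)‖ ≤ C * (E₀ * Real.exp (-(r₁ * (domSys P M j).dj X))) := fun s => by
    rw [norm_mul]
    exact mul_le_mul (hKb s) (hold j X _ (hmaps Y j X ξ hξ A hA s)) (norm_nonneg _) hC
  calc ‖∫ s, R.K Y j X s * old j X (R.cfg Y j X ξ A s) ∂(R.μ Y j X)‖
      ≤ C * (E₀ * Real.exp (-(r₁ * (domSys P M j).dj X))) * (R.μ Y j X).real univ :=
        norm_integral_le_of_norm_le_const (Eventually.of_forall hpt)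
    _ ≤ C * (E₀ * Real.exp (-(r₁ * (domSys P M j).dj X))) * m := mul_le_mul_of_nonneg_left hmass hc

/-! ## §5  Analytic faces: holomorphy in the configuration, along admissible history curves, continuity ∕ measurability in the field -/

section Analytic

variable [NormedRing 𝔸] [NormedAlgebra ℂ 𝔸] [TopologicalSpace S] [OpensMeasurableSpace S]

/-- **FACE — HOLOMORPHY OF THE READ POTENTIAL IN THE CONFIGURATION, EVERY ADMISSIBLE HISTORY** (the record's `h𝒪d`): on an open window `W` on
which the configuration families move analytically and stay in the tables, for a history bounded and analytic on the tables ([I] §1 p. 263)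
and a field in `𝔅`, `ξ ↦ 𝒪_R(old, ξ; Y, A)` is complex differentiable on `W` — by the dominated holomorphic parametric-integral lemma applied to
`K(s)·E^{(j)}(X; cfg(ξ, A, s))` (bounded kernel × (1.18)-bounded analytic function of a configuration moving analytically inside the table).
[cite: Balaban1987RG1, §1 p.263, (3.10) p.272 and (3.15)-(3.18) p.273; Balaban1988RG2Cluster, Lemma 2 (1.41) p.11 and (2.14) p.15 ll.19-20] -/
theorem differentiableOn_potential_config_of_admHist {sp : (j : ℕ) → (domSys P M j).Dom → Set (CPair P 𝔸)} {W : Set (CPair P 𝔸)}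
    {𝔅 : Set ((𝔇.𝒦 Z t).Λ → ℝ)} {C m E₀ r₁ : ℝ} (hW : IsOpen W) (hmaps : R.MapsToTables sp W 𝔅) (hhol : R.CfgHoloOn W 𝔅)
    (hcont : R.CfgContinuous) (hK : R.KernelBounded C) (hμ : R.FiniteMass m) {old : OlderTerms P 𝔸 M k} (hold : old ∈ AdmHist sp E₀ r₁ k)
    {A : (𝔇.𝒦 Z t).Λ → ℝ} (hA : A ∈ 𝔅) (Y : TDom P.d (L * domCount P M (k + 1))) :
    DifferentiableOn ℂ (fun ξ : CPair P 𝔸 => R.potential old ξ Y A) W := by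
  refine DifferentiableOn.fun_sum fun j _ => DifferentiableOn.fun_sum fun X _ => ?_
  obtain ⟨hKm, hKb⟩ := hK Y j X
  obtain ⟨hfin, -⟩ := hμ Y j X
  haveI := hfin
  refine Literature.Analysis.Complex.differentiableOn_integral_of_dominated (fun ξ hξ => ?_) (Eventually.of_forall fun s => ?_)
    (fun ξ₀ hξ₀ => ?_)
  · have hc : Continuous fun s : S => old j X (R.cfg Y j X ξ A s) :=
      continuous_iff_continuousAt.2 fun s =>
        ((hold.2 j X) _ (hmaps Y j X ξ hξ A hA s)).continuousAt.comp (hcont Y j X ξ A).continuousAt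
    exact hKm.aestronglyMeasurable.mul hc.aestronglyMeasurable
  · exact (differentiableOn_const _).mul fun ξ hξ =>
      ((hold.2 j X) _ (hmaps Y j X ξ hξ A hA s)).differentiableAt.comp_differentiableWithinAt ξ (hhol Y j X A hA s ξ hξ)
  · obtain ⟨ε, hε, hball⟩ := Metric.isOpen_iff.1 hW ξ₀ hξ₀
    refine ⟨ε, hε, hball, fun _ => C * (E₀ * Real.exp (-(r₁ * (domSys P M j).dj X))), integrable_const _,
      Eventually.of_forall fun s ξ hξ => ?_⟩
    rw [norm_mul]
    exact mul_le_mul (hKb s) (hold.1 j X _ (hmaps Y j X ξ (hball hξ) A hA s)) (norm_nonneg _) ((norm_nonneg _).trans (hKb s))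

/-- **FACE — HOLOMORPHY OF THE READ POTENTIAL ALONG EVERY ADMISSIBLE HOLOMORPHIC HISTORY CURVE** (the record's `hOhol`, binder for binder at
`sp := spaceOfRecord …`, `r₁ := κ_E`, `(domSys P M j).dj X = torusTreeLen X.1`): for `ξ ∈ W`, `A ∈ 𝔅`, an open `O ⊆ ℂ` and a curve of histories
`cv : ℂ → OlderTerms` whose values at every table point move holomorphically in `z` with the (1.18) bound, and are analytic on the tables for each
`z ∈ O`, the read potential `z ↦ 𝒪_R(cv z, ξ; Y, A)` is complex differentiable on `O` — the same lemma, the parameter now being `z`.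
[cite: Balaban1987RG1, §1 p.263 with (1.18), (3.4) p.270 and (3.15)-(3.18) p.273; Balaban1988RG2Cluster, Lemma 1 (1.33)-(1.35) p.9 and Lemma 2 (1.41) p.11] -/
theorem differentiableOn_potential_history_of_curve {sp : (j : ℕ) → (domSys P M j).Dom → Set (CPair P 𝔸)} {W : Set (CPair P 𝔸)}
    {𝔅 : Set ((𝔇.𝒦 Z t).Λ → ℝ)} {C m E₀ r₁ : ℝ} {O : Set ℂ} (hO : IsOpen O) (hmaps : R.MapsToTables sp W 𝔅) (hcont : R.CfgContinuous)
    (hK : R.KernelBounded C) (hμ : R.FiniteMass m) {ξ : CPair P 𝔸} (hξ : ξ ∈ W) {A : (𝔇.𝒦 Z t).Λ → ℝ} (hA : A ∈ 𝔅)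
    {cv : ℂ → OlderTerms P 𝔸 M k}
    (hcv : ∀ (j : Fin (k + 1)) (X : (domSys P M j).Dom) (ψ : CPair P 𝔸), ψ ∈ sp j X →
      DifferentiableOn ℂ (fun z => cv z j X ψ) O ∧ ∀ z ∈ O, ‖cv z j X ψ‖ ≤ E₀ * Real.exp (-(r₁ * (domSys P M j).dj X)))
    (hcvA : ∀ z ∈ O, ∀ (j : Fin (k + 1)) (X : (domSys P M j).Dom), AnalyticOnNhd ℂ (cv z j X) (sp j X))
    (Y : TDom P.d (L * domCount P M (k + 1))) :
    DifferentiableOn ℂ (fun z : ℂ => R.potential (cv z) ξ Y A) O := by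
  refine DifferentiableOn.fun_sum fun j _ => DifferentiableOn.fun_sum fun X _ => ?_
  obtain ⟨hKm, hKb⟩ := hK Y j X
  obtain ⟨hfin, -⟩ := hμ Y j X
  haveI := hfin
  refine Literature.Analysis.Complex.differentiableOn_integral_of_dominated (fun z hz => ?_) (Eventually.of_forall fun s => ?_)
    (fun z₀ hz₀ => ?_)
  · have hc : Continuous fun s : S => cv z j X (R.cfg Y j X ξ A s) :=
      continuous_iff_continuousAt.2 fun s =>
        ((hcvA z hz j X) _ (hmaps Y j X ξ hξ A hA s)).continuousAt.comp (hcont Y j X ξ A).continuousAt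
    exact hKm.aestronglyMeasurable.mul hc.aestronglyMeasurable
  · exact (differentiableOn_const _).mul (hcv j X _ (hmaps Y j X ξ hξ A hA s)).1
  · obtain ⟨ε, hε, hball⟩ := Metric.isOpen_iff.1 hO z₀ hz₀
    refine ⟨ε, hε, hball, fun _ => C * (E₀ * Real.exp (-(r₁ * (domSys P M j).dj X))), integrable_const _,
      Eventually.of_forall fun s z hz => ?_⟩
    rw [norm_mul]
    exact mul_le_mul (hKb s) ((hcv j X _ (hmaps Y j X ξ hξ A hA s)).2 z (hball hz)) (norm_nonneg _) ((norm_nonneg _).trans (hKb s))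

/-- **FACE — CONTINUITY OF THE READ POTENTIAL IN THE FIELD ON THE FIELD SET, EVERY ADMISSIBLE HISTORY**: when the configuration families
are jointly continuous in (field, parameter) and stay in the tables for the fields of `𝔅`, `A ↦ 𝒪_R(old, ξ; Y, A)` is continuous ON `𝔅` (dominated
convergence with the (1.18) bound) — the located form (print's box `𝔅 = FieldBox S₀ ρ`; a consumer reading the potential at clipped fields
composes with its clipping map). [cite: Balaban1987RG1, §1 p.263 with (1.18) and (3.10) p.272; Balaban1988RG2Cluster, (1.34) p.9 and Lemma 2 (1.41) p.11] -/
theorem continuousOn_potential_field_of_admHist {sp : (j : ℕ) → (domSys P M j).Dom → Set (CPair P 𝔸)} {W : Set (CPair P 𝔸)}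
    {𝔅 : Set ((𝔇.𝒦 Z t).Λ → ℝ)} {C m E₀ r₁ : ℝ} (hmaps : R.MapsToTables sp W 𝔅) (hjc : R.CfgJointContinuous) (hK : R.KernelBounded C)
    (hμ : R.FiniteMass m) {old : OlderTerms P 𝔸 M k} (hold : old ∈ AdmHist sp E₀ r₁ k) {ξ : CPair P 𝔸} (hξ : ξ ∈ W)
    (Y : TDom P.d (L * domCount P M (k + 1))) :
    ContinuousOn (fun A : (𝔇.𝒦 Z t).Λ → ℝ => R.potential old ξ Y A) 𝔅 := by
  refine continuousOn_finsetSum _ fun j _ => continuousOn_finsetSum _ fun X _ => ?_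
  obtain ⟨hKm, hKb⟩ := hK Y j X
  obtain ⟨hfin, -⟩ := hμ Y j X
  haveI := hfin
  have hcA : ∀ A ∈ 𝔅, Continuous fun s : S => old j X (R.cfg Y j X ξ A s) := fun A hA =>
    (hold.2 j X).continuousOn.comp_continuous ((hjc Y j X ξ).comp (Continuous.prodMk_right A)) fun s => hmaps Y j X ξ hξ A hA s
  have hcs : ∀ s : S, ContinuousOn (fun A : (𝔇.𝒦 Z t).Λ → ℝ => old j X (R.cfg Y j X ξ A s)) 𝔅 := fun s =>
    (hold.2 j X).continuousOn.comp ((hjc Y j X ξ).comp (Continuous.prodMk_left s)).continuousOn fun A hA => hmaps Y j X ξ hξ A hA s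
  refine continuousOn_of_dominated (F := fun (A : (𝔇.𝒦 Z t).Λ → ℝ) (s : S) => R.K Y j X s * old j X (R.cfg Y j X ξ A s))
    (bound := fun _ => C * (E₀ * Real.exp (-(r₁ * (domSys P M j).dj X)))) (fun A hA => ?_) (fun A hA => Eventually.of_forall fun s => ?_)
    (integrable_const _) (Eventually.of_forall fun s => ?_)
  · exact hKm.aestronglyMeasurable.mul (hcA A hA).aestronglyMeasurable
  · rw [norm_mul]
    exact mul_le_mul (hKb s) (hold.1 j X _ (hmaps Y j X ξ hξ A hA s)) (norm_nonneg _) ((norm_nonneg _).trans (hKb s))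
  · exact continuousOn_const.mul (hcs s)

/-- **FACE — CONTINUITY OF THE READ POTENTIAL IN THE FIELD, EVERY ADMISSIBLE HISTORY**, when the configuration families are jointly continuous in
(field, parameter) and stay in the tables for EVERY field (`𝔅 = univ`: the clamped reading): `A ↦ 𝒪_R(old, ξ; Y, A)` is continuous — dominated
convergence with the (1.18) bound. [cite: Balaban1987RG1, §1 p.263 with (1.18) and (3.10) p.272; Balaban1988RG2Cluster, Lemma 2 (1.41) p.11] -/
theorem continuous_potential_field_of_admHist {sp : (j : ℕ) → (domSys P M j).Dom → Set (CPair P 𝔸)} {W : Set (CPair P 𝔸)} {C m E₀ r₁ : ℝ}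
    (hmaps : R.MapsToTables sp W univ) (hjc : R.CfgJointContinuous) (hK : R.KernelBounded C) (hμ : R.FiniteMass m)
    {old : OlderTerms P 𝔸 M k} (hold : old ∈ AdmHist sp E₀ r₁ k) {ξ : CPair P 𝔸} (hξ : ξ ∈ W) (Y : TDom P.d (L * domCount P M (k + 1))) :
    Continuous fun A : (𝔇.𝒦 Z t).Λ → ℝ => R.potential old ξ Y A :=
  continuousOn_univ.1 (R.continuousOn_potential_field_of_admHist hmaps hjc hK hμ hold hξ Y)

/-- **FACE — MEASURABILITY OF THE READ POTENTIAL IN THE FIELD, EVERY ADMISSIBLE HISTORY** (the record's `h𝒪m`, for the clamped reading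
`𝔅 = univ`): a continuous function of the field is measurable. [cite: Balaban1987RG1, §1 p.263 and (3.10) p.272; Balaban1988RG2Cluster, Lemma 2 (1.41) p.11] -/
theorem measurable_potential_field_of_admHist {sp : (j : ℕ) → (domSys P M j).Dom → Set (CPair P 𝔸)} {W : Set (CPair P 𝔸)} {C m E₀ r₁ : ℝ}
    (hmaps : R.MapsToTables sp W univ) (hjc : R.CfgJointContinuous) (hK : R.KernelBounded C) (hμ : R.FiniteMass m)
    {old : OlderTerms P 𝔸 M k} (hold : old ∈ AdmHist sp E₀ r₁ k) {ξ : CPair P 𝔸} (hξ : ξ ∈ W) (Y : TDom P.d (L * domCount P M (k + 1))) :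
    Measurable fun A : (𝔇.𝒦 Z t).Λ → ℝ => R.potential old ξ Y A :=
  (R.continuous_potential_field_of_admHist hmaps hjc hK hμ hold hξ Y).measurable

end Analytic

end ReadingAtoms

/-! ## §6  The datum-level reading and the hypothesis schema on an opaque older-terms potential -/

variable {𝔇}

/-- **THE OLDER-TERMS POTENTIAL READ BY A FAMILY OF READINGS** (one reading per term slice, common parameter space `S`): the `UnscaledOlder` of
W1-11 given slice by slice by `ReadingAtoms.potential`. [cite: Balaban1987RG1, (2.10) p.267 and (2.12)-(2.13) p.268; Balaban1988RG2Cluster, Lemma 2 (1.41) p.11] -/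
def readOlder {S : Type*} [MeasurableSpace S] (R : (Z : (domSys P M (k + 1)).Dom) → (t : TermLabel P M k L) → 𝔇.ReadingAtoms Z t S) :
    𝔇.UnscaledOlder :=
  fun Z t => (R Z t).potential

/-- Face: the read potential at a slice (`rfl`). [cite: Balaban1988RG2Cluster, Lemma 2 (1.41) p.11 (bookkeeping)] -/
@[simp] theorem readOlder_apply {S : Type*} [MeasurableSpace S]
    (R : (Z : (domSys P M (k + 1)).Dom) → (t : TermLabel P M k L) → 𝔇.ReadingAtoms Z t S) (Z : (domSys P M (k + 1)).Dom) (t : TermLabel P M k L)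
    (old : OlderTerms P 𝔸 M k) (ξ : CPair P 𝔸) (Y : TDom P.d (L * domCount P M (k + 1))) (A : (𝔇.𝒦 Z t).Λ → ℝ) :
    𝔇.readOlder R Z t old ξ Y A = (R Z t).potential old ξ Y A :=
  rfl

/-- **HYPOTHESIS SCHEMA (global): the opaque older-terms potential `𝒪` IS READ by the family of readings `R`** — everywhere.
[cite: Balaban1988RG2Cluster, Lemma 1 (1.33) p.9 and Lemma 2 (1.41) p.11] -/
def ReadsBy (𝒪 : 𝔇.UnscaledOlder) {S : Type*} [MeasurableSpace S]
    (R : (Z : (domSys P M (k + 1)).Dom) → (t : TermLabel P M k L) → 𝔇.ReadingAtoms Z t S) : Prop :=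
  ∀ (Z : (domSys P M (k + 1)).Dom) (t : TermLabel P M k L) (old : OlderTerms P 𝔸 M k) (ξ : CPair P 𝔸) (Y : TDom P.d (L * domCount P M (k + 1)))
    (A : (𝔇.𝒦 Z t).Λ → ℝ), 𝒪 Z t old ξ Y A = (R Z t).potential old ξ Y A

/-- **HYPOTHESIS SCHEMA (located, one slice): `𝒪` is read by `R` on the admissible histories `Adm`, the configuration window `W` and the field
set `𝔅`** — the identity (1.33) ∕ (1.41) where print states it ((1.34): configurations in the enlarged space, `|B| < ε₁g_k⁻¹ on Y`; [I] §1 p. 263: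
histories satisfying the inductive assumptions). [cite: Balaban1988RG2Cluster, Lemma 1 (1.33)-(1.35) p.9 and Lemma 2 (1.41) p.11; Balaban1987RG1, §1 p.263] -/
def ReadsOnBy (𝒪 : 𝔇.UnscaledOlder) (Z : (domSys P M (k + 1)).Dom) (t : TermLabel P M k L) {S : Type*} [MeasurableSpace S]
    (R : 𝔇.ReadingAtoms Z t S) (Adm : Set (OlderTerms P 𝔸 M k)) (W : Set (CPair P 𝔸)) (𝔅 : Set ((𝔇.𝒦 Z t).Λ → ℝ)) : Prop :=
  ∀ old ∈ Adm, ∀ ξ ∈ W, ∀ (Y : TDom P.d (L * domCount P M (k + 1))), ∀ A ∈ 𝔅, 𝒪 Z t old ξ Y A = R.potential old ξ Y A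

/-- Face: the read potential is read by its readings (`rfl`). [cite: Balaban1988RG2Cluster, Lemma 2 (1.41) p.11 (bookkeeping)] -/
theorem readsBy_readOlder {S : Type*} [MeasurableSpace S]
    (R : (Z : (domSys P M (k + 1)).Dom) → (t : TermLabel P M k L) → 𝔇.ReadingAtoms Z t S) : 𝔇.ReadsBy (𝔇.readOlder R) R :=
  fun _ _ _ _ _ _ => rfl

/-- Face: a globally read `𝒪` IS `readOlder R` (function extensionality). [cite: Balaban1988RG2Cluster, Lemma 2 (1.41) p.11 (bookkeeping)] -/
theorem ReadsBy.eq_readOlder {𝒪 : 𝔇.UnscaledOlder} {S : Type*} [MeasurableSpace S]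
    {R : (Z : (domSys P M (k + 1)).Dom) → (t : TermLabel P M k L) → 𝔇.ReadingAtoms Z t S} (h : 𝔇.ReadsBy 𝒪 R) : 𝒪 = 𝔇.readOlder R :=
  funext fun Z => funext fun t => funext fun old => funext fun ξ => funext fun Y => funext fun A => h Z t old ξ Y A

/-- Face: global reading implies located reading on any classes. [cite: Balaban1988RG2Cluster, Lemma 2 (1.41) p.11 (bookkeeping)] -/
theorem ReadsBy.readsOnBy {𝒪 : 𝔇.UnscaledOlder} {S : Type*} [MeasurableSpace S]
    {R : (Z : (domSys P M (k + 1)).Dom) → (t : TermLabel P M k L) → 𝔇.ReadingAtoms Z t S} (h : 𝔇.ReadsBy 𝒪 R)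
    (Z : (domSys P M (k + 1)).Dom) (t : TermLabel P M k L) (Adm : Set (OlderTerms P 𝔸 M k)) (W : Set (CPair P 𝔸))
    (𝔅 : Set ((𝔇.𝒦 Z t).Λ → ℝ)) : 𝔇.ReadsOnBy 𝒪 Z t (R Z t) Adm W 𝔅 :=
  fun old _ ξ _ Y A _ => h Z t old ξ Y A

/-- Face: a located reading restricts to smaller classes. [cite: Balaban1988RG2Cluster, Lemma 2 (1.41) p.11 (bookkeeping)] -/
theorem ReadsOnBy.mono {𝒪 : 𝔇.UnscaledOlder} {Z : (domSys P M (k + 1)).Dom} {t : TermLabel P M k L} {S : Type*} [MeasurableSpace S]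
    {R : 𝔇.ReadingAtoms Z t S} {Adm Adm' : Set (OlderTerms P 𝔸 M k)} {W W' : Set (CPair P 𝔸)} {𝔅 𝔅' : Set ((𝔇.𝒦 Z t).Λ → ℝ)}
    (h : 𝔇.ReadsOnBy 𝒪 Z t R Adm W 𝔅) (hAdm : Adm' ⊆ Adm) (hW : W' ⊆ W) (h𝔅 : 𝔅' ⊆ 𝔅) : 𝔇.ReadsOnBy 𝒪 Z t R Adm' W' 𝔅' :=
  fun old hold ξ hξ Y A hA => h old (hAdm hold) ξ (hW hξ) Y A (h𝔅 hA)

/-! ## §7  Transfer faces: the located inputs of an opaque `𝒪` read on the admissible class -/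

namespace ReadsOnBy

variable [NormedRing 𝔸] [NormedAlgebra ℂ 𝔸]
variable {𝒪 : 𝔇.UnscaledOlder} {Z : (domSys P M (k + 1)).Dom} {t : TermLabel P M k L} {S : Type*} [MeasurableSpace S]
  {R : 𝔇.ReadingAtoms Z t S} {sp : (j : ℕ) → (domSys P M j).Dom → Set (CPair P 𝔸)} {W : Set (CPair P 𝔸)}
  {𝔅 : Set ((𝔇.𝒦 Z t).Λ → ℝ)} {E₀ r₁ : ℝ}

/-- Transfer: field locality of a read `𝒪` on the located classes (the record's `hloc𝒪` at `𝔅 = univ`).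
[cite: Balaban1988RG2Cluster, (2.2)-(2.3) p.12 and Lemma 2 (1.41) p.11] -/
theorem local_of_localIn (h : 𝔇.ReadsOnBy 𝒪 Z t R (AdmHist sp E₀ r₁ k) W 𝔅) {S₀ : Set (𝔇.𝒦 Z t).Λ} (hloc : R.LocalIn S₀)
    {old : OlderTerms P 𝔸 M k} (hold : old ∈ AdmHist sp E₀ r₁ k) {ξ : CPair P 𝔸} (hξ : ξ ∈ W) {Y : TDom P.d (L * domCount P M (k + 1))}
    (hY : Y ∈ t.1) {A A' : (𝔇.𝒦 Z t).Λ → ℝ} (hA : A ∈ 𝔅) (hA' : A' ∈ 𝔅) (hAA' : ∀ b ∈ S₀, A b = A' b) :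
    𝒪 Z t old ξ Y A = 𝒪 Z t old ξ Y A' := by
  rw [h old hold ξ hξ Y A hA, h old hold ξ hξ Y A' hA', R.potential_local_of_localIn hloc old ξ hY hAA']

variable [TopologicalSpace S] [OpensMeasurableSpace S]

/-- Transfer: holomorphy in the configuration of a read `𝒪`, every admissible history (the record's `h𝒪d`).
[cite: Balaban1987RG1, §1 p.263 and (3.10) p.272; Balaban1988RG2Cluster, Lemma 2 (1.41) p.11 and (2.14) p.15 ll.19-20] -/
theorem differentiableOn_config {C m : ℝ} (h : 𝔇.ReadsOnBy 𝒪 Z t R (AdmHist sp E₀ r₁ k) W 𝔅) (hW : IsOpen W) (hmaps : R.MapsToTables sp W 𝔅)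
    (hhol : R.CfgHoloOn W 𝔅) (hcont : R.CfgContinuous) (hK : R.KernelBounded C) (hμ : R.FiniteMass m) {old : OlderTerms P 𝔸 M k}
    (hold : old ∈ AdmHist sp E₀ r₁ k) (Y : TDom P.d (L * domCount P M (k + 1))) {A : (𝔇.𝒦 Z t).Λ → ℝ} (hA : A ∈ 𝔅) :
    DifferentiableOn ℂ (fun ξ : CPair P 𝔸 => 𝒪 Z t old ξ Y A) W :=
  (R.differentiableOn_potential_config_of_admHist hW hmaps hhol hcont hK hμ hold hA Y).congr fun ξ hξ => h old hold ξ hξ Y A hA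

/-- Transfer: holomorphy of a read `𝒪` along every admissible holomorphic history curve (the record's `hOhol`): the curve's values lie in the
admissible class at every `z ∈ O`, so the located identity applies along it. [cite: Balaban1987RG1, §1 p.263 with (1.18) and (3.15)-(3.18) p.273; Balaban1988RG2Cluster, Lemma 1 (1.33) p.9 and Lemma 2 (1.41) p.11] -/
theorem differentiableOn_history {C m : ℝ} {O : Set ℂ} (h : 𝔇.ReadsOnBy 𝒪 Z t R (AdmHist sp E₀ r₁ k) W 𝔅) (hO : IsOpen O)
    (hmaps : R.MapsToTables sp W 𝔅) (hcont : R.CfgContinuous) (hK : R.KernelBounded C) (hμ : R.FiniteMass m) {ξ : CPair P 𝔸} (hξ : ξ ∈ W)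
    {cv : ℂ → OlderTerms P 𝔸 M k}
    (hcv : ∀ (j : Fin (k + 1)) (X : (domSys P M j).Dom) (ψ : CPair P 𝔸), ψ ∈ sp j X →
      DifferentiableOn ℂ (fun z => cv z j X ψ) O ∧ ∀ z ∈ O, ‖cv z j X ψ‖ ≤ E₀ * Real.exp (-(r₁ * (domSys P M j).dj X)))
    (hcvA : ∀ z ∈ O, ∀ (j : Fin (k + 1)) (X : (domSys P M j).Dom), AnalyticOnNhd ℂ (cv z j X) (sp j X))
    (Y : TDom P.d (L * domCount P M (k + 1))) {A : (𝔇.𝒦 Z t).Λ → ℝ} (hA : A ∈ 𝔅) :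
    DifferentiableOn ℂ (fun z : ℂ => 𝒪 Z t (cv z) ξ Y A) O := by
  have hmem : ∀ z ∈ O, cv z ∈ AdmHist sp E₀ r₁ k := fun z hz =>
    ⟨fun j X ψ hψ => (hcv j X ψ hψ).2 z hz, fun j X => hcvA z hz j X⟩
  exact (R.differentiableOn_potential_history_of_curve hO hmaps hcont hK hμ hξ hA hcv hcvA Y).congr fun z hz =>
    h (cv z) (hmem z hz) ξ hξ Y A hA

/-- Transfer: continuity in the field ON THE FIELD SET of a read `𝒪`, every admissible history (located form).
[cite: Balaban1987RG1, §1 p.263 and (3.10) p.272; Balaban1988RG2Cluster, (1.34) p.9 and Lemma 2 (1.41) p.11] -/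
theorem continuousOn_field {C m : ℝ} (h : 𝔇.ReadsOnBy 𝒪 Z t R (AdmHist sp E₀ r₁ k) W 𝔅) (hmaps : R.MapsToTables sp W 𝔅)
    (hjc : R.CfgJointContinuous) (hK : R.KernelBounded C) (hμ : R.FiniteMass m) {old : OlderTerms P 𝔸 M k} (hold : old ∈ AdmHist sp E₀ r₁ k)
    {ξ : CPair P 𝔸} (hξ : ξ ∈ W) (Y : TDom P.d (L * domCount P M (k + 1))) :
    ContinuousOn (fun A : (𝔇.𝒦 Z t).Λ → ℝ => 𝒪 Z t old ξ Y A) 𝔅 :=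
  (R.continuousOn_potential_field_of_admHist hmaps hjc hK hμ hold hξ Y).congr fun A hA => h old hold ξ hξ Y A hA

/-- Transfer: measurability in the field of a read `𝒪`, every admissible history (the record's `h𝒪m`), for the clamped reading `𝔅 = univ`.
[cite: Balaban1987RG1, §1 p.263 and (3.10) p.272; Balaban1988RG2Cluster, Lemma 2 (1.41) p.11] -/
theorem measurable_field {C m : ℝ} (h : 𝔇.ReadsOnBy 𝒪 Z t R (AdmHist sp E₀ r₁ k) W univ) (hmaps : R.MapsToTables sp W univ)
    (hjc : R.CfgJointContinuous) (hK : R.KernelBounded C) (hμ : R.FiniteMass m) {old : OlderTerms P 𝔸 M k} (hold : old ∈ AdmHist sp E₀ r₁ k)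
    {ξ : CPair P 𝔸} (hξ : ξ ∈ W) (Y : TDom P.d (L * domCount P M (k + 1))) :
    Measurable fun A : (𝔇.𝒦 Z t).Λ → ℝ => 𝒪 Z t old ξ Y A := by
  have : (fun A : (𝔇.𝒦 Z t).Λ → ℝ => 𝒪 Z t old ξ Y A) = fun A => R.potential old ξ Y A :=
    funext fun A => h old hold ξ hξ Y A (mem_univ _)
  rw [this]
  exact R.measurable_potential_field_of_admHist hmaps hjc hK hμ hold hξ Y

end ReadsOnBy

end TermDatum214

end W1

end Literature.MathematicalPhysics.QuantumFieldTheory.Balaban1983to89.Node00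

end
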